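import Mathlib.MeasureTheory.Integral.Lebesgue.Basic
import Mathlib.Analysis.SpecialFunctions.ImproperIntegrals
import Mathlib.Analysis.SpecialFunctions.Pow.Real
import Mathlib.Analysis.SpecificLimits.Basic
import Mathlib.Tactic

/-!
# Weight OUTSIDE versus weight INSIDE a flux integral along `Σ_*`: the dyadic conversion and its failure at the critical exponent (Klainerman–Szeftel Thm M2 / Giorgi–Klainerman–Szeftel Thm 12.4.4)

CITATION HEADER (lean-in-tree rule 2026-08-18).  This module is FOLKLORE real analysis, written to make one piece of
bookkeeping between the two published papers

* S. Klainerman, J. Szeftel, *Kerr stability for small angular momentum*, arXiv:2104.11857 (v1; TeX `Main-Kerr-arxiv.tex`,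
  lines `KS l.N`) = bib key `KlainermanSzeftel2021` (journal: Pure Appl. Math. Q. **19** (2023), `KlainermanSzeftel2023`);
* E. Giorgi, S. Klainerman, J. Szeftel, *Wave equations estimates and the nonlinear stability of slowly rotating Kerr black
  holes*, arXiv:2205.14808 (v1; TeX `FinalKerrarxivversion.tex`, lines `GKS l.N`) = bib key `GiorgiKlainermanSzeftel2022`
  (journal: Pure Appl. Math. Q. **20** (2024), `GiorgiKlainermanSzeftel2024`, Thm 12.4.4 = journal Thm 12.4.5),

checkable by `lean`.  THE BOOKKEEPING.  KS Theorem M2 (KS l.6695) and the GKS introduction (GKS l.1840) state the decay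
of the extreme curvature component `α̲` along the last slice `Σ_*` with the weight INSIDE the integral,
`∫_{Σ_*} u^{2+2δ_dec} |𝔡^k α̲|² ≲ ε₀²`; the precise GKS Theorem 12.4.4 (GKS l.24284–24287) and the last display of its
proof (GKS §12.4.5, l.25138–25140: "`∫_{Σ_*(≥τ)}|𝔡^{≤k_L−7}α̲|² ≲ ε₀²τ^{−2−2δ_dec}` as stated", l.25141 "This concludes
the proof of Theorem M2") give the weight OUTSIDE at the SAME exponent, `∫_{Σ_*(≥τ)} |𝔡^{≤k_L−7} α̲|² ≲ ε₀² τ^{-2-2δ_dec}`,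
for all `1 ≤ τ ≤ τ_*` (GKS's conclusion is on the bounded range `[1, τ_*]`, `τ_*` the value of the time function on the last
sphere; this module MODELS the tails hypothesis on `[1,∞)` — harmless both for the conversion lemma, which is monotone in
the range, and for the critical-exponent failure of §4, since the `τ_*`-truncated density family exhibits the same
divergence as `τ_* → ∞`; audit-cell referee note N-3).  With `p := 2 + 2δ_dec`, a nonnegative density `f` on `[1,∞)` (the
`Σ_*`-flux density of `|𝔡^k α̲|²` in the time function) and tails `∫_{≥τ} f ≤ C τ^{-p}`:
* §2–§3 (`lintegral_weight_le_tsum_dyadic`, `weightInside_of_tails`, `weightInside_rpow_of_tails`): weight-outside at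
  exponent `p` gives weight-inside `∫_{≥1} u^q f ≤ C · 2^q / (1 − 2^{q−p})` for EVERY `0 ≤ q < p` (dyadic decomposition
  `[2^n, 2^{n+1})`, monotone weight, geometric series) — finite iff `q < p` (`dyadicConstant_lt_top_iff`);
* §4 (`critical_tails`, `critical_not_integrable`, `subcritical_integral`): at `q = p` the conversion FAILS: the density
  `f_p(u) = p u^{-1-p}` has tails EXACTLY `τ^{-p}` for every `τ > 0` and `u^p f_p(u) = p/u` is not integrable on `(1,∞)`,
  while for `q < p` its weighted integral is the sharp constant `p/(p − q) ↑ ∞`;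
* §1 (`finiteDyadic_sum_le`) is the same conversion for finitely many dyadic block masses in elementary form, and
  `finiteDyadic_critical` the block-mass witness of the failure at `q = p` (partial sums grow linearly).
So the Σ_*-clause of KS Thm M2 AS PRINTED (weight inside, exponent `2+2δ_dec`) does not follow from GKS Thm 12.4.4 AS
PRINTED (weight outside, exponent `2+2δ_dec`) by this — the standard — conversion, and no conversion can work for all
densities obeying the GKS bound (§4); it does follow at every exponent `2+2δ_dec−2δ'`, `δ' > 0`, with constant
`≈ 1/δ'`.  This is the audit cell `pub-kerr`'s finding "E19" (cell file GAPS.md; LEMMAS.md edge E-M2 (ii); the cell's DAG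
module `Literature.Geometry.Lorentzian.KlainermanSzeftel2021.Dag` keeps the corresponding edge `EdgeM2flux` as a NAMED,
undischarged hypothesis over abstract carriers — this module does not touch it).  Whether the loss `δ'` is affordable
downstream (KS ch. 5 consumes M2 at `k ≤ k_small + 80`) or whether GKS §12.4 has slack `τ^{-2-2δ_dec-2δ'}` in its
nonlinear terms is NOT addressed here (GAPS.md E19 repairs R1/R2; the constant ledger of the companion module
`InterpolatedRates` records where such slack would come from).  Nothing in this file is a statement about the Einstein
equations; nothing here is Final-State-Conjecture progress.  Mathlib only.

## Contents
* §1 `finiteDyadic_sum_le`, `finiteDyadic_critical` (elementary, real);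
* §2 `lintegral_weight_le_tsum_dyadic` (core, `ℝ≥0∞`); §3 `weightInside_of_tails`, `dyadicConstant_lt_top_iff`,
  `weightInside_rpow_of_tails`;
* §4 `critical_tails`, `critical_not_integrable`, `subcritical_integral` (real Bochner integrals).
-/

noncomputable section

open Set Filter
open _root_.MeasureTheory
open scoped ENNReal NNReal Topology

namespace Literature.Geometry.Lorentzian.GiorgiKlainermanSzeftel2022.FluxWeightPlacement

/-! ## §1 Finitely many dyadic blocks (elementary form) -/

/-- Dyadic conversion, elementary form.  Block masses `m j` (think `m j = ∫_{[2^j,2^{j+1})} f ≥ 0`) dominated by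
`C β^j` (think `β = 2^{-p}`, from the tail bound at `τ = 2^j`, `C ≥ 0` the flux constant), block weights `α^{j+1}` (think
`α = 2^q`, the sup of `u^q` on the block) with `α, β ≥ 0`, `αβ < 1` (i.e. `q < p`): every partial weighted sum is
`≤ C α / (1 − αβ)`.  [folklore] -/
theorem finiteDyadic_sum_le {m : ℕ → ℝ} {C α β : ℝ} (hC : 0 ≤ C) (hα : 0 ≤ α) (hβ : 0 ≤ β) (hαβ : α * β < 1)
    (hm : ∀ j, m j ≤ C * β ^ j) (N : ℕ) :
    ∑ j ∈ Finset.range N, α ^ (j + 1) * m j ≤ C * α / (1 - α * β) := by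
  have hr0 : 0 ≤ α * β := mul_nonneg hα hβ
  have h1 : ∑ j ∈ Finset.range N, α ^ (j + 1) * m j ≤ ∑ j ∈ Finset.range N, C * α * (α * β) ^ j := by
    refine Finset.sum_le_sum fun j _ => ?_
    calc α ^ (j + 1) * m j ≤ α ^ (j + 1) * (C * β ^ j) := mul_le_mul_of_nonneg_left (hm j) (pow_nonneg hα _)
      _ = C * α * (α * β) ^ j := by rw [mul_pow, pow_succ]; ring
  have hgeom : (∑ j ∈ Finset.range N, (α * β) ^ j) ≤ 1 / (1 - α * β) := by
    rw [le_div_iff₀ (by linarith), geom_sum_mul_neg]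
    have : 0 ≤ (α * β) ^ N := pow_nonneg hr0 N
    linarith
  calc ∑ j ∈ Finset.range N, α ^ (j + 1) * m j ≤ ∑ j ∈ Finset.range N, C * α * (α * β) ^ j := h1
    _ = C * α * ∑ j ∈ Finset.range N, (α * β) ^ j := by rw [Finset.mul_sum]
    _ ≤ C * α * (1 / (1 - α * β)) := mul_le_mul_of_nonneg_left hgeom (mul_nonneg hC hα)
    _ = C * α / (1 - α * β) := by ring

/-- Failure at the critical exponent, elementary form (`α β = 1`, i.e. `q = p`; here `α = b`, `β = b⁻¹`, `b > 1`): the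
block masses `m j := C (1 − b⁻¹) b^{-j}` are `≥ 0`, have tails EXACTLY `∑_{i ≥ j} m i = C b^{-j}` (so every tail bound
holds), yet the weighted partial sums `∑_{j<N} b^{j+1} m j = N · C (b − 1)` are unbounded.  Stated with finite sums only:
the tail identity as `∑_{j ≤ i < j+M} m i = C b^{-j} (1 − b^{-M})`.  [folklore] -/
theorem finiteDyadic_critical {C b : ℝ} (hb : 1 < b) (N M j : ℕ) :
    (∑ i ∈ Finset.range M, C * (1 - b⁻¹) * b⁻¹ ^ (j + i) = C * b⁻¹ ^ j * (1 - b⁻¹ ^ M)) ∧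
      ∑ i ∈ Finset.range N, b ^ (i + 1) * (C * (1 - b⁻¹) * b⁻¹ ^ i) = N * (C * (b - 1)) := by
  have hb0 : b ≠ 0 := by positivity
  constructor
  · have : ∑ i ∈ Finset.range M, C * (1 - b⁻¹) * b⁻¹ ^ (j + i)
        = C * b⁻¹ ^ j * ((∑ i ∈ Finset.range M, b⁻¹ ^ i) * (1 - b⁻¹)) := by
      rw [Finset.sum_mul, Finset.mul_sum]
      refine Finset.sum_congr rfl fun i _ => ?_
      rw [pow_add]; ring
    rw [this, geom_sum_mul_neg]
  · have hconst : ∀ i ∈ Finset.range N, b ^ (i + 1) * (C * (1 - b⁻¹) * b⁻¹ ^ i) = C * (b - 1) := by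
      intro i _
      rw [pow_succ, inv_pow]
      field_simp
    rw [Finset.sum_congr rfl hconst, Finset.sum_const, Finset.card_range, nsmul_eq_mul]

/-! ## §2 The core conversion (Lebesgue integral of a nonnegative density, `ℝ≥0∞`-valued) -/

/-- Core dyadic conversion.  For a nonnegative measurable density `f` on `ℝ` and a weight `w` monotone on `[1,∞)`:
`∫_{[1,∞)} w·f ≤ ∑_n w(2^{n+1}) · ∫_{[2^n,∞)} f` — weight-inside is controlled by weight-at-dyadic-points times TAILS.
[folklore] -/
theorem lintegral_weight_le_tsum_dyadic {f w : ℝ → ℝ≥0∞} (hf : Measurable f) (hw : MonotoneOn w (Ici 1)) :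
    ∫⁻ x in Ici (1:ℝ), w x * f x ≤ ∑' n : ℕ, w (2 ^ (n + 1)) * ∫⁻ x in Ici ((2:ℝ) ^ n), f x := by
  have hcover : Ici (1:ℝ) ⊆ ⋃ n : ℕ, Ico ((2:ℝ) ^ n) (2 ^ (n + 1)) := by
    intro x hx
    obtain ⟨n, hn, hn'⟩ := exists_nat_pow_near (mem_Ici.mp hx) (one_lt_two : (1:ℝ) < 2)
    exact mem_iUnion.mpr ⟨n, hn, hn'⟩
  have hone : ∀ n : ℕ, (1:ℝ) ≤ 2 ^ n := fun n => one_le_pow₀ (by norm_num)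
  calc ∫⁻ x in Ici (1:ℝ), w x * f x
      ≤ ∫⁻ x in ⋃ n : ℕ, Ico ((2:ℝ) ^ n) (2 ^ (n + 1)), w x * f x := lintegral_mono_set hcover
    _ ≤ ∑' n : ℕ, ∫⁻ x in Ico ((2:ℝ) ^ n) (2 ^ (n + 1)), w x * f x := lintegral_iUnion_le _ _
    _ ≤ ∑' n : ℕ, w (2 ^ (n + 1)) * ∫⁻ x in Ici ((2:ℝ) ^ n), f x := by
        refine ENNReal.tsum_le_tsum fun n => ?_
        calc ∫⁻ x in Ico ((2:ℝ) ^ n) (2 ^ (n + 1)), w x * f x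
            ≤ ∫⁻ x in Ico ((2:ℝ) ^ n) (2 ^ (n + 1)), w (2 ^ (n + 1)) * f x := by
                refine setLIntegral_mono' measurableSet_Ico fun x hx => ?_
                have hx1 : x ∈ Ici (1:ℝ) := mem_Ici.mpr ((hone n).trans hx.1)
                exact mul_le_mul' (hw hx1 (mem_Ici.mpr (hone (n + 1))) hx.2.le) le_rfl
          _ = w (2 ^ (n + 1)) * ∫⁻ x in Ico ((2:ℝ) ^ n) (2 ^ (n + 1)), f x := lintegral_const_mul _ hf
          _ ≤ w (2 ^ (n + 1)) * ∫⁻ x in Ici ((2:ℝ) ^ n), f x :=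
                mul_le_mul' le_rfl (lintegral_mono_set Ico_subset_Ici_self)

/-! ## §3 Tails `≤ C β^n` at the dyadic points ⟹ weight-inside bound with the geometric constant -/

/-- Weight-outside ⟹ weight-inside, abstract exponents: tails `∫_{[2^n,∞)} f ≤ C β^n` and dyadic weights
`w(2^{n+1}) ≤ α^{n+1}` give `∫_{[1,∞)} w f ≤ C α (1 − αβ)⁻¹` (in `ℝ≥0∞`; the right side is finite iff `αβ < 1` and
`C α < ∞`, see `dyadicConstant_lt_top_iff`).  [folklore] -/
theorem weightInside_of_tails {f w : ℝ → ℝ≥0∞} (hf : Measurable f) (hw : MonotoneOn w (Ici 1)) {C α β : ℝ≥0∞}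
    (htail : ∀ n : ℕ, ∫⁻ x in Ici ((2:ℝ) ^ n), f x ≤ C * β ^ n) (hwt : ∀ n : ℕ, w (2 ^ (n + 1)) ≤ α ^ (n + 1)) :
    ∫⁻ x in Ici (1:ℝ), w x * f x ≤ C * α * (1 - α * β)⁻¹ := by
  calc ∫⁻ x in Ici (1:ℝ), w x * f x ≤ ∑' n : ℕ, w (2 ^ (n + 1)) * ∫⁻ x in Ici ((2:ℝ) ^ n), f x :=
        lintegral_weight_le_tsum_dyadic hf hw
    _ ≤ ∑' n : ℕ, α ^ (n + 1) * (C * β ^ n) := ENNReal.tsum_le_tsum fun n => mul_le_mul' (hwt n) (htail n)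
    _ = ∑' n : ℕ, C * α * (α * β) ^ n := by
        refine tsum_congr fun n => ?_
        rw [mul_pow, pow_succ]; ring
    _ = C * α * (1 - α * β)⁻¹ := by rw [ENNReal.tsum_mul_left, ENNReal.tsum_geometric]

/-- The geometric factor `(1 − αβ)⁻¹` is finite iff `αβ < 1` (i.e. iff the inside exponent `q` is STRICTLY below the
outside exponent `p` when `α = 2^q`, `β = 2^{-p}`).  [folklore] -/
theorem dyadicConstant_lt_top_iff (α β : ℝ≥0∞) : (1 - α * β)⁻¹ < ∞ ↔ α * β < 1 := by
  rw [ENNReal.inv_lt_top, tsub_pos_iff_lt]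

/-- Weight-outside ⟹ weight-inside with real power weights: if `∫_{[τ,∞)} f ≤ C τ^{-p}` for all `τ ≥ 1` then, for every
`0 ≤ q < p`, `∫_{[1,∞)} u^q f(u) du ≤ C · 2^q · (1 − 2^{q−p})⁻¹ < ∞` (for `C < ∞`).  With `p = 2 + 2δ_dec` and
`q = 2 + 2δ_dec − 2δ'` this is the passage from GKS Thm 12.4.4's `∫_{Σ_*(≥τ)}|𝔡^{≤k}α̲|² ≲ ε₀²τ^{-2-2δ_dec}` (GKS
l.24284–24287) to a KS-Thm-M2-type bound `∫_{Σ_*} u^{2+2δ_dec−2δ'}|𝔡^kα̲|² ≲_{δ'} ε₀²` (KS l.6695 has `δ' = 0`, which §4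
shows is not obtainable this way; locators GKS Thm 12.4.4 TeX l.24284–24287, KS Thm M2 TeX l.6695 — the theorem itself is
elementary and proved here). [folklore] -/
theorem weightInside_rpow_of_tails {f : ℝ → ℝ≥0∞} (hf : Measurable f) {C : ℝ≥0∞} {p q : ℝ} (hq : 0 ≤ q)
    (hqp : q < p) (htail : ∀ τ : ℝ, 1 ≤ τ → ∫⁻ x in Ici τ, f x ≤ C * ENNReal.ofReal (τ ^ (-p))) :
    ∫⁻ x in Ici (1:ℝ), ENNReal.ofReal (x ^ q) * f x
        ≤ C * ENNReal.ofReal (2 ^ q) * (1 - ENNReal.ofReal ((2:ℝ) ^ (q - p)))⁻¹ ∧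
      (1 - ENNReal.ofReal ((2:ℝ) ^ (q - p)))⁻¹ < ∞ := by
  have h2 : (0:ℝ) ≤ 2 := by norm_num
  -- the dyadic data
  have hα : ∀ n : ℕ, ENNReal.ofReal (((2:ℝ) ^ (n + 1)) ^ q) ≤ ENNReal.ofReal (2 ^ q) ^ (n + 1) := by
    intro n
    rw [← ENNReal.ofReal_pow (by positivity)]
    apply le_of_eq; congr 1
    rw [← Real.rpow_natCast, ← Real.rpow_mul h2, ← Real.rpow_natCast, ← Real.rpow_mul h2, mul_comm]
  have hβ : ∀ n : ℕ, ∫⁻ x in Ici ((2:ℝ) ^ n), f x ≤ C * ENNReal.ofReal ((2:ℝ) ^ (-p)) ^ n := by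
    intro n
    have h := htail ((2:ℝ) ^ n) (one_le_pow₀ (by norm_num))
    rw [← ENNReal.ofReal_pow (by positivity)]
    convert h using 3
    rw [← Real.rpow_natCast, ← Real.rpow_mul h2, ← Real.rpow_natCast, ← Real.rpow_mul h2, mul_comm]
  have hw : MonotoneOn (fun x : ℝ => ENNReal.ofReal (x ^ q)) (Ici 1) := by
    intro x hx y hy hxy
    exact ENNReal.ofReal_le_ofReal (Real.rpow_le_rpow (zero_le_one.trans (mem_Ici.mp hx)) hxy hq)
  have hmain := weightInside_of_tails hf hw hβ hα
  have hprod : ENNReal.ofReal ((2:ℝ) ^ q) * ENNReal.ofReal ((2:ℝ) ^ (-p)) = ENNReal.ofReal ((2:ℝ) ^ (q - p)) := by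
    rw [← ENNReal.ofReal_mul (by positivity), ← Real.rpow_add (by norm_num : (0:ℝ) < 2), sub_eq_add_neg]
  rw [hprod] at hmain
  refine ⟨hmain, ?_⟩
  rw [ENNReal.inv_lt_top, tsub_pos_iff_lt, ENNReal.ofReal_lt_one]
  exact Real.rpow_lt_one_of_one_lt_of_neg one_lt_two (by linarith)

/-! ## §4 The critical exponent: tails exactly `τ^{-p}`, weight-inside at exponent `p` divergent -/

/-- The critical density `f_p(u) = p u^{-1-p}` has tails EXACTLY `τ^{-p}` for every `τ > 0` — it satisfies the
weight-OUTSIDE bound with constant `1` and equality.  [folklore] -/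
theorem critical_tails {p : ℝ} (hp : 0 < p) {τ : ℝ} (hτ : 0 < τ) :
    ∫ x in Ioi τ, p * x ^ (-1 - p) = τ ^ (-p) := by
  rw [integral_const_mul, integral_Ioi_rpow_of_lt (by linarith) hτ]
  have : -1 - p + 1 = -p := by ring
  rw [this]
  field_simp

/-- … while with the weight INSIDE at the same exponent, `u^p f_p(u) = p/u` is NOT integrable on `(1,∞)`: the Σ_*-clause
of KS Thm M2 as printed (weight `u^{2+2δ_dec}` inside) is not a consequence of GKS Thm 12.4.4 as printed (weight
`τ^{-2-2δ_dec}` outside) for all densities obeying the latter.  [folklore] -/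
theorem critical_not_integrable {p : ℝ} (hp : 0 < p) :
    ¬ IntegrableOn (fun x : ℝ => x ^ p * (p * x ^ (-1 - p))) (Ioi 1) := by
  intro h
  have heq : EqOn (fun x : ℝ => p⁻¹ * (x ^ p * (p * x ^ (-1 - p)))) (fun x : ℝ => x ^ (-1:ℝ)) (Ioi 1) := by
    intro x hx
    have hx0 : 0 < x := zero_lt_one.trans (mem_Ioi.mp hx)
    simp only
    rw [show x ^ p * (p * x ^ (-1 - p)) = p * (x ^ p * x ^ (-1 - p)) by ring, ← Real.rpow_add hx0,
      show p + (-1 - p) = -1 by ring]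
    field_simp
  have h1 : IntegrableOn (fun x : ℝ => p⁻¹ * (x ^ p * (p * x ^ (-1 - p)))) (Ioi 1) := h.const_mul p⁻¹
  have h' : IntegrableOn (fun x : ℝ => x ^ (-1:ℝ)) (Ioi 1) := IntegrableOn.congr_fun h1 heq measurableSet_Ioi
  have := (integrableOn_Ioi_rpow_iff zero_lt_one).mp h'
  norm_num at this

/-- Sub-critical weights, sharp constant: for `q < p`, `∫_{(1,∞)} u^q f_p(u) du = p/(p − q)` (`↑ ∞` as `q ↑ p`; compare
the geometric constant `2^q (1 − 2^{q−p})⁻¹ ≈ 1/((p−q) log 2)` of §3).  [folklore] -/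
theorem subcritical_integral {p q : ℝ} (hqp : q < p) :
    ∫ x in Ioi (1:ℝ), x ^ q * (p * x ^ (-1 - p)) = p / (p - q) := by
  have heq : EqOn (fun x : ℝ => x ^ q * (p * x ^ (-1 - p))) (fun x : ℝ => p * x ^ (q - 1 - p)) (Ioi 1) := by
    intro x hx
    have hx0 : 0 < x := zero_lt_one.trans (mem_Ioi.mp hx)
    simp only
    rw [show x ^ q * (p * x ^ (-1 - p)) = p * (x ^ q * x ^ (-1 - p)) by ring, ← Real.rpow_add hx0,
      show q + (-1 - p) = q - 1 - p by ring]
  rw [setIntegral_congr_fun measurableSet_Ioi heq, integral_const_mul,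
    integral_Ioi_rpow_of_lt (by linarith) zero_lt_one, Real.one_rpow]
  have : q - 1 - p + 1 = q - p := by ring
  rw [this]
  have hne : q - p ≠ 0 := by linarith
  have hne' : p - q ≠ 0 := by linarith
  field_simp
  ring

end Literature.Geometry.Lorentzian.GiorgiKlainermanSzeftel2022.FluxWeightPlacement

end
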